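import Literature.Analysis.FluidPDE.CheskidovShvydkoyRegularProofs
import Literature.Analysis.FluidPDE.TaoLocalisationHolds
import Literature.Analysis.FluidPDE.ClassicalSobolevUniqueness
import Literature.Analysis.FluidPDE.ClassicalSolutionGlue

/-!
# Rung `X_1` of the Type I certificate ladder — the `H¹` blow-up rate at a singular time

Theorems file for the crux `RungReynoldsOne` (item stmt-NavierStokesRegularity-2882, line
`lp-vorticity-young-budget`, stub S6 `stub_h1BlowupRate`).

**Statement.** There is a universal constant `c > 0` (Tao's `H¹` lifespan constant, Tao 2013,
Thm. 5.4 (ii)+(iv), tree theorem `tao2011_smooth_local_existence_holds`) such that: if a classical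
solution `(u, p)` of the unforced Navier–Stokes system on `ℝ³ × [0, T)`, Leray–Hopf from its
rapidly decaying datum `u 0`, admits NO classical extension past `T`, then for every `t ∈ [0, T)`
`c ν³ ≤ (‖u(t)‖²_{L²} + ‖∇u(t)‖²_{L²})² (T − t)` (in `ℝ≥0∞`). This is Leray's lower bound on the
rate of blow-up in `H¹` (Leray 1934, §20; Robinson–Rodrigo–Sadowski 2016, Lemma 6.11 / (8.2)), here
with the constant of Tao's smooth local theory.

**Proof.** Otherwise `A²(T − t) < cν³` with `A = ‖u(t)‖²_{H¹}` finite, so there is `T₂ > T − t` with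
`A² T₂ ≤ c ν³`. The slice `u t` is smooth, divergence free and has all `L²` Sobolev norms finite
(Tao 2013, Cor. 11.1: `tao2011_hasBoundedSobolevNormsOn_holds` on the closed sub-slab
`[0, (t + T)/2]`, the energy being bounded by the initial energy,
`IsLerayHopfOn.lintegral_enorm_sq_le`). Tao's local theorem produces a classical solution `v` on
`[0, T₂]` from `u t` with all Sobolev norms bounded; by uniqueness in this class
(`IsClassicalNSSolutionOn.eq_of_hasBoundedSobolevNormsOn`, Majda–Bertozzi 2002, Cor. 3.1) it
coincides with `u(· + t)` on `[0, T − t)`, hence extends the translate past `T − t`, and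
`HasSmoothExtensionPast.of_translate` (or `t = 0` directly) contradicts the hypothesis.

## References

* J. Leray, Acta Math. 63 (1934), §20. [Leray1934]
* J. C. Robinson, J. L. Rodrigo, W. Sadowski, *The Three-Dimensional Navier–Stokes Equations*,
  CUP 2016, Lemma 6.11, (8.2). [RobinsonRodrigoSadowski2016]
* T. Tao, Anal. PDE 6 (2013) = arXiv:1108.1165, Thm. 5.4 (ii)+(iv), Cor. 11.1. [Tao2011]
-/

noncomputable section

open Set Filter Topology MeasureTheory
open scoped RealInnerProductSpace ENNReal NNReal Laplacian ContDiff
open Literature.Analysis.FluidPDE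

namespace Summit.NavierStokesRegularity.NavierStokesRegularity.Theorems.RungReynoldsOne

-- The summit namespace `Summit.NavierStokesRegularity.NavierStokesRegularity.…` is fixed by the
-- route (problem and summit share the name), so the duplicated component is intended.
set_option linter.dupNamespace false

/-- **Tao-class regularity on closed sub-slabs.** A classical solution of the unforced system on
`ℝ³ × [0, T)`, Leray–Hopf from its rapidly decaying datum, has all `L²` Sobolev norms bounded on
every closed sub-slab `[0, T'']`, `0 < T'' < T` (Tao 2013, Cor. 11.1 with Cor. 4.3 and Thm. 5.4
(iv): `tao2011_hasBoundedSobolevNormsOn_holds`; the energy on `[0, T'']` is bounded by the initial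
energy, `IsLerayHopfOn.lintegral_enorm_sq_le`). [cite: Tao2011, Cor. 11.1 + Cor. 4.3 + Thm. 5.4 (iv)] -/
theorem hasBoundedSobolevNormsOn_subslab {ν T : ℝ} (hν : 0 < ν)
    {u : ℝ → EuclideanSpace ℝ (Fin 3) → EuclideanSpace ℝ (Fin 3)}
    {p : ℝ → EuclideanSpace ℝ (Fin 3) → ℝ}
    (hsol : IsClassicalNSSolutionOn (Ico 0 T) ν 0 u p) (hLH : IsLerayHopfOn T ν 0 (u 0) u)
    (h₀ : HasRapidSpatialDecay (u 0)) {T'' : ℝ} (h0 : 0 < T'') (hT'' : T'' < T) :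
    HasBoundedSobolevNormsOn (Icc 0 T'') u := by
  have hsol' : IsClassicalNSSolutionOn (Icc 0 T'') ν 0 u p :=
    hsol.mono (Icc_subset_Ico_right hT'') (uniqueDiffOn_Icc h0)
  refine tao2011_hasBoundedSobolevNormsOn_holds hν h0 hsol' ?_ h₀
  exact ⟨(2 * VectorCalculus.kineticEnergy (u 0)).toNNReal, fun s hs =>
    hLH.lintegral_enorm_sq_le hν.le ⟨hs.1, hs.2.trans hT''.le⟩⟩

/-- **Choice of the lifespan.** If `A² (T − t) < c ν³` then some `T₂ > T − t` still has
`A² T₂ ≤ c ν³` (elementary). [folklore] -/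
theorem exists_lifespan_gt {A c ν T t : ℝ} (hc : 0 < c) (hν : 0 < ν)
    (hlt : A ^ 2 * (T - t) < c * ν ^ 3) :
    ∃ T₂ : ℝ, T - t < T₂ ∧ A ^ 2 * T₂ ≤ c * ν ^ 3 := by
  rcases (sq_nonneg A).eq_or_lt with h0 | hpos
  · exact ⟨T - t + 1, by linarith, by rw [← h0, zero_mul]; positivity⟩
  · refine ⟨c * ν ^ 3 / A ^ 2, (lt_div_iff₀' hpos).2 hlt, ?_⟩
    rw [mul_div_cancel₀ _ hpos.ne']

/-- **S6 — the `H¹` blow-up rate at a time with no classical extension** (Leray 1934 §20;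
Robinson–Rodrigo–Sadowski 2016 Lemma 6.11 / (8.2); here with Tao's lifespan constant): there is a
universal `c > 0` such that if a classical solution on `ℝ³ × [0,T)`, Leray–Hopf from its rapidly
decaying datum, has NO classical extension past `T`, then `cν³ ≤ (‖u(t)‖₂² + ‖∇u(t)‖₂²)²(T−t)` for
every `t ∈ [0,T)` (in `ℝ≥0∞`). Proof: otherwise pick `T₂ > T − t` with `A²T₂ ≤ cν³`,
`A = ‖u(t)‖₂² + ‖∇u(t)‖₂²`; Tao's local solution `v` from the `H^∞` slice `u t`
(`tao2011_smooth_local_existence_holds`; Sobolev finiteness of `u t` from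
`tao2011_hasBoundedSobolevNormsOn_holds` on `[0,t']`, `t < t' < T`) lives on `[0,T₂]` and coincides
with `u(·+t)` on `[0,T−t)` (`IsClassicalNSSolutionOn.eq_of_hasBoundedSobolevNormsOn` on each
`[0,s]`); so `v` extends `u(·+t)` past `T−t` and `HasSmoothExtensionPast.of_translate` (or
`t = 0` directly) contradicts the hypothesis. [cite: RobinsonRodrigoSadowski2016, Lemma 6.11 and (8.2); Leray1934, §20; Tao2011, Thm. 5.4 (ii)+(iv)] -/
theorem stub_h1BlowupRate :
    ∃ c : ℝ, 0 < c ∧ ∀ ⦃ν T : ℝ⦄, 0 < ν → 0 < T →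
    ∀ ⦃u : ℝ → EuclideanSpace ℝ (Fin 3) → EuclideanSpace ℝ (Fin 3)⦄
      ⦃p : ℝ → EuclideanSpace ℝ (Fin 3) → ℝ⦄,
      IsClassicalNSSolutionOn (Ico 0 T) ν 0 u p → IsLerayHopfOn T ν 0 (u 0) u →
      HasRapidSpatialDecay (u 0) → ¬ HasSmoothExtensionPast ν 0 u T →
    ∀ t ∈ Ico 0 T,
      ENNReal.ofReal (c * ν ^ 3) ≤
        ((∫⁻ x, ‖u t x‖ₑ ^ 2) + ∫⁻ x, ENNReal.ofReal (frobeniusNormSq (fderiv ℝ (u t) x))) ^ 2 *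
          ENNReal.ofReal (T - t) := by
  obtain ⟨c, hc, hloc⟩ := tao2011_smooth_local_existence_holds
  refine ⟨c, hc, ?_⟩
  intro ν T hν _hT u p hsol hLH h₀ hnot t ht
  have hreg : ∀ T'', 0 < T'' → T'' < T → HasBoundedSobolevNormsOn (Icc 0 T'') u :=
    fun T'' h0 hT'' => hasBoundedSobolevNormsOn_subslab hν hsol hLH h₀ h0 hT''
  set E : ℝ≥0∞ := ∫⁻ x, ‖u t x‖ₑ ^ 2 with hE
  set G : ℝ≥0∞ := ∫⁻ x, ENNReal.ofReal (frobeniusNormSq (fderiv ℝ (u t) x)) with hG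
  have hTt : 0 < T - t := sub_pos.2 ht.2
  -- the infinite case is trivial
  rcases eq_or_ne (E + G) ⊤ with htop | hfin
  · rw [htop, ENNReal.top_pow two_ne_zero, ENNReal.top_mul (ENNReal.ofReal_pos.2 hTt).ne']
    exact le_top
  -- otherwise argue by contradiction
  by_contra hle
  have hlt := not_le.1 hle
  set A : ℝ := (E + G).toReal with hA
  have hA0 : 0 ≤ A := ENNReal.toReal_nonneg
  have hEG : E + G = ENNReal.ofReal A := (ENNReal.ofReal_toReal hfin).symm
  have hlt' : A ^ 2 * (T - t) < c * ν ^ 3 := by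
    rw [hEG, ← ENNReal.ofReal_pow hA0, ← ENNReal.ofReal_mul (sq_nonneg _),
      ENNReal.ofReal_lt_ofReal_iff (mul_pos hc (pow_pos hν 3))] at hlt
    exact hlt
  -- the lifespan `T₂ > T - t` with `A² T₂ ≤ c ν³`
  obtain ⟨T₂, hT₂, hT₂c⟩ := exists_lifespan_gt hc hν hlt'
  have hT₂pos : 0 < T₂ := hTt.trans hT₂
  -- the datum `u t`: smooth, divergence free, all Sobolev norms finite
  have hHk : ∀ n : ℕ, ∫⁻ x, ‖iteratedFDeriv ℝ n (u t) x‖ₑ ^ 2 < ⊤ := fun n => by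
    obtain ⟨C, hC⟩ := hreg ((t + T) / 2) (by linarith [ht.1, ht.2]) (by linarith [ht.2]) n
    exact (hC t ⟨ht.1, by linarith [ht.2]⟩).trans_lt ENNReal.coe_lt_top
  have hAle : E + G ≤ ENNReal.ofReal A := hEG.le
  -- Tao's local classical solution `v` on `[0, T₂]` from `u t`
  obtain ⟨v, q, hv, hv0, hvB, -, -, -⟩ :=
    hloc hν hT₂pos (hsol.contDiff_velocity ht) (hsol.divFree t ht) hHk hA0 hAle hT₂c
  -- uniqueness on `[0, T - t)`: `u (· + t) = v`
  have huniq : ∀ τ ∈ Ico 0 (T - t), u (τ + t) = v τ := by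
    intro τ hτ
    obtain ⟨hτ0, hτT⟩ := hτ
    set S : ℝ := (τ + (T - t)) / 2 with hS
    have hτS : τ ≤ S := by linarith
    have hS' : S < T - t := by linarith
    have hST₂ : S ≤ T₂ := by linarith
    have hS0 : 0 < S := by linarith
    have h1 : IsClassicalNSSolutionOn (Icc 0 S) ν 0 (fun r => u (r + t)) (fun r => p (r + t)) :=
      (hsol.translate_Ico_zero ht.1).mono (Icc_subset_Ico_right hS') (uniqueDiffOn_Icc hS0)
    have h2 : IsClassicalNSSolutionOn (Icc 0 S) ν 0 v q :=
      hv.mono (Icc_subset_Icc_right hST₂) (uniqueDiffOn_Icc hS0)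
    have hB1 : HasBoundedSobolevNormsOn (Icc 0 S) (fun r => u (r + t)) := by
      have h := hreg (S + t) (by linarith [ht.1]) (by linarith)
      intro n
      obtain ⟨C, hC⟩ := h n
      exact ⟨C, fun r hr => hC (r + t) ⟨by linarith [hr.1, ht.1], by linarith [hr.2]⟩⟩
    have hB2 : HasBoundedSobolevNormsOn (Icc 0 S) v := hvB.mono (Icc_subset_Icc_right hST₂)
    have h0 : (fun r => u (r + t)) 0 = v 0 := by simp only [zero_add, hv0]
    exact h1.eq_of_hasBoundedSobolevNormsOn h2 hν.le hS0 hB1 hB2 h0 ⟨hτ0, hτS⟩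
  -- `v` continues the translate past `T - t`
  have hext : HasSmoothExtensionPast ν 0 (fun τ => u (τ + t)) (T - t) :=
    ⟨T₂, hT₂, v, q, hv.mono Ico_subset_Icc_self (uniqueDiffOn_Ico 0 T₂),
      fun τ hτ => (huniq τ hτ).symm⟩
  rcases ht.1.eq_or_lt with ht0 | ht0
  · apply hnot
    subst ht0
    simpa using hext
  · exact hnot (HasSmoothExtensionPast.of_translate hsol ht0 ht.2 hext)

end Summit.NavierStokesRegularity.NavierStokesRegularity.Theorems.RungReynoldsOne

end
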